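import Mathlib

/-!
# THEOREM Z (the ZONE LEMMA of C-041.md §12) — marks of a colouring of terminal edges and the pattern swap
(p6, gen 27; mine-3's LEAN SHEET C-041.md §12 (k))

A family of terminal edges `T` with its vertex map `at_ : T → V` and a colouring `m : T → Bool` (`true` = red).
The MARKS `markSet at_ m b` = the vertices carrying a terminal edge of colour `b` (`Bl` / `Blt` / `M` / `Mt` of §12
are the four instances); `ConstAt at_ m v` = the colouring is constant at `v` (all-red or all-blue, or no edge);
`swapMark at_ X m` exchanges the two constant colourings at every vertex outside `X` and fixes every mixed
colouring and every vertex of `X` (the involution `(F_U)` of §12 (c) with `U = V ∖ X`).  Proved: constancy is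
preserved (`constAt_swapMark_iff`), the swap is an involution (`swapMark_swapMark`), and its marks: inside `X`
unchanged (`mem_markSet_swapMark_of_mem`), outside `X` the `b`-marks become the `!b`-marks
(`mem_markSet_swapMark_of_not_mem` — a mixed vertex carries both marks before and after).
-/

namespace PercRepro

namespace ZoneZ

variable {V : Type*}

/-! ## Marks of a colouring of terminal edges -/

/-- The vertices carrying a terminal edge (of the family `at`) of colour `b`. -/
def markSet {T : Type*} (at_ : T → V) (m : T → Bool) (b : Bool) : Set V := {v | ∃ t, at_ t = v ∧ m t = b}

/-- The colouring `m` is constant on the terminal edges at `v`. -/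
def ConstAt {T : Type*} (at_ : T → V) (m : T → Bool) (v : V) : Prop :=
  ∀ t t', at_ t = v → at_ t' = v → m t = m t'

open Classical in
/-- Exchange the two constant colourings (all-red ↔ all-blue) at every vertex outside `X`; every mixed colouring and
every vertex of `X` is left alone. -/
noncomputable def swapMark {T : Type*} (at_ : T → V) (X : Set V) (m : T → Bool) : T → Bool := fun t =>
  if at_ t ∉ X ∧ ConstAt at_ m (at_ t) then !m t else m t

/-- The swap leaves the terminal edges at the vertices of `X` alone. -/
theorem swapMark_of_mem {T : Type*} (at_ : T → V) (X : Set V) (m : T → Bool) {t : T} (h : at_ t ∈ X) :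
    swapMark at_ X m t = m t := by
  unfold swapMark
  rw [if_neg]
  rintro ⟨h', _⟩
  exact h' h

/-- The swap complements a constant colouring at a vertex outside `X`. -/
theorem swapMark_of_const {T : Type*} (at_ : T → V) (X : Set V) (m : T → Bool) {t : T} (h : at_ t ∉ X)
    (hc : ConstAt at_ m (at_ t)) : swapMark at_ X m t = !m t := by
  unfold swapMark
  rw [if_pos ⟨h, hc⟩]

/-- The swap leaves a mixed colouring alone. -/
theorem swapMark_of_not_const {T : Type*} (at_ : T → V) (X : Set V) (m : T → Bool) {t : T}
    (hc : ¬ ConstAt at_ m (at_ t)) : swapMark at_ X m t = m t := by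
  unfold swapMark
  rw [if_neg]
  rintro ⟨_, h'⟩
  exact hc h'

/-- Constancy at a vertex is preserved by the swap. -/
theorem constAt_swapMark_iff {T : Type*} (at_ : T → V) (X : Set V) (m : T → Bool) (v : V) :
    ConstAt at_ (swapMark at_ X m) v ↔ ConstAt at_ m v := by
  by_cases hv : v ∈ X
  · constructor
    · intro h t t' ht ht'
      have := h t t' ht ht'
      rwa [swapMark_of_mem at_ X m (ht ▸ hv), swapMark_of_mem at_ X m (ht' ▸ hv)] at this
    · intro h t t' ht ht'
      rw [swapMark_of_mem at_ X m (ht ▸ hv), swapMark_of_mem at_ X m (ht' ▸ hv)]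
      exact h t t' ht ht'
  · by_cases hc : ConstAt at_ m v
    · constructor
      · intro _
        exact hc
      · intro _ t t' ht ht'
        rw [swapMark_of_const at_ X m (ht ▸ hv) (ht ▸ hc), swapMark_of_const at_ X m (ht' ▸ hv) (ht' ▸ hc)]
        rw [hc t t' ht ht']
    · constructor
      · intro h
        exfalso
        apply hc
        intro t t' ht ht'
        have := h t t' ht ht'
        rwa [swapMark_of_not_const at_ X m (ht ▸ hc), swapMark_of_not_const at_ X m (ht' ▸ hc)] at this
      · intro h
        exact absurd h hc

/-- The swap is an involution. -/
theorem swapMark_swapMark {T : Type*} (at_ : T → V) (X : Set V) (m : T → Bool) :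
    swapMark at_ X (swapMark at_ X m) = m := by
  funext t
  by_cases hv : at_ t ∈ X
  · rw [swapMark_of_mem at_ X _ hv, swapMark_of_mem at_ X m hv]
  · by_cases hc : ConstAt at_ m (at_ t)
    · rw [swapMark_of_const at_ X _ hv ((constAt_swapMark_iff at_ X m _).2 hc), swapMark_of_const at_ X m hv hc,
        Bool.not_not]
    · rw [swapMark_of_not_const at_ X _ (fun h => hc ((constAt_swapMark_iff at_ X m _).1 h)),
        swapMark_of_not_const at_ X m hc]

/-- Inside `X` the marks of the swapped colouring are the marks of the colouring. -/
theorem mem_markSet_swapMark_of_mem {T : Type*} (at_ : T → V) (X : Set V) (m : T → Bool) (b : Bool) {v : V}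
    (hv : v ∈ X) : v ∈ markSet at_ (swapMark at_ X m) b ↔ v ∈ markSet at_ m b := by
  constructor
  · rintro ⟨t, ht, hm⟩
    rw [swapMark_of_mem at_ X m (ht ▸ hv)] at hm
    exact ⟨t, ht, hm⟩
  · rintro ⟨t, ht, hm⟩
    refine ⟨t, ht, ?_⟩
    rw [swapMark_of_mem at_ X m (ht ▸ hv)]
    exact hm

/-- Outside `X` the `b`-marks of the swapped colouring are the `!b`-marks of the colouring. -/
theorem mem_markSet_swapMark_of_not_mem {T : Type*} (at_ : T → V) (X : Set V) (m : T → Bool) (b : Bool) {v : V}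
    (hv : v ∉ X) : v ∈ markSet at_ (swapMark at_ X m) b ↔ v ∈ markSet at_ m (!b) := by
  by_cases hc : ConstAt at_ m v
  · constructor
    · rintro ⟨t, ht, hm⟩
      rw [swapMark_of_const at_ X m (ht ▸ hv) (ht ▸ hc)] at hm
      refine ⟨t, ht, ?_⟩
      rw [← hm, Bool.not_not]
    · rintro ⟨t, ht, hm⟩
      refine ⟨t, ht, ?_⟩
      rw [swapMark_of_const at_ X m (ht ▸ hv) (ht ▸ hc), hm, Bool.not_not]
  · -- a mixed colouring at `v`: both marks are present before and after
    have hmix : ∃ t₁ t₂, at_ t₁ = v ∧ at_ t₂ = v ∧ m t₁ ≠ m t₂ := by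
      by_contra h
      apply hc
      intro t t' ht ht'
      by_contra hne
      exact h ⟨t, t', ht, ht', hne⟩
    obtain ⟨t₁, t₂, ht₁, ht₂, hne⟩ := hmix
    have key : ∀ b' : Bool, v ∈ markSet at_ m b' := by
      intro b'
      cases h1 : m t₁ <;> cases h2 : m t₂ <;> cases b'
      · exact ⟨t₁, ht₁, h1⟩
      · exact absurd (h1.trans h2.symm) hne
      · exact ⟨t₁, ht₁, h1⟩
      · exact ⟨t₂, ht₂, h2⟩
      · exact ⟨t₂, ht₂, h2⟩
      · exact ⟨t₁, ht₁, h1⟩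
      · exact absurd (h1.trans h2.symm) hne
      · exact ⟨t₁, ht₁, h1⟩
    have key' : ∀ b' : Bool, v ∈ markSet at_ (swapMark at_ X m) b' := by
      intro b'
      obtain ⟨t, ht, hm⟩ := key b'
      refine ⟨t, ht, ?_⟩
      rw [swapMark_of_not_const at_ X m (ht ▸ hc)]
      exact hm
    exact iff_of_true (key' b) (key (!b))

end ZoneZ

end PercRepro
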